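import Summits.ValiantsHypothesis.ValiantsHypothesis.Theorems.ValuativeGCTValuativeFlipDetEffectiveMonotone
import Summits.ValiantsHypothesis.ValiantsHypothesis.Theorems.ValuativeGCTValuativeFlipLiftSurjective
import Literature.Computability.AlgebraicComplexity.DeterminantalComplexityUniform

/-!
# The stable value of the determinant's ray is the inner plethysm coefficient (`μ₂ ≤ n`)
# (crux `ValuativeGCT.ValuativeFlip`, stmt-ValiantsHypothesis-12624; wall-breaker axis
# "representation-stability transfer `m ↔ m + 1`", k16 gen 1, seat 3)

Letters as in `…RayStability.lean`: `K(j) = K_{n+j}((μ♯(n+j))*) = mult ℂ[Δ(det_{n+j})]`, `a(j) = a_{μ♯}(δ[n+j])`.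
Seat 2 of this axis proved that `K(j)` is eventually constant `= K∞(μ)` with `K∞ ≤ a∞ ≤ g∞` (`rayLimits_chain`);
k4 gen 1 seat 2 proved exact inner plethysm stability `a(j) = a_μ(δ[n])` for `μ₂ ≤ n` (`plethysmCoeff_rowLift_eq`).
With Ikenmeyer–Panova's Prop. 2.6(b) (`plethysmCoeff_le_orbitMultiplicity_rowLift`, in the Manivel range where every
form of degree `n` on `Mat_n` has an affine determinantal expression of size `n + j`,
`exists_forall_hasDetRepr_of_isHomogeneous`) the stable value is IDENTIFIED:

* `det_ray_eq_plethysm_eventually` — for `μ₂ ≤ n` there is `j₀` with `K(j) = a(j) = a_μ(δ[n])` for all `j ≥ j₀`: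
  far out on a Kadish–Landsberg ray the determinant orbit closure has NO equation of type `(μ♯)*` in degree `δ`;
* `det_rayLimit_eq_plethysm_base` — hence **`K∞(μ) = a_μ(δ[n])`** for any eventual value `K∞` of the ray (`μ₂ ≤ n`);
* `det_ray_sandwich` — with the effective monotonicity of this seat: **`K_n(μ*) ≤ K(j) ≤ a_μ(δ[n]) = K∞(μ)` for every
  `j ≥ 2(n+1)^10`** (`μ₂ ≤ n`): the ray climbs from the inner determinant multiplicity to the inner plethysm
  coefficient, without long-range drops (`det_ray_mono_of_le`).

So for `μ₂ ≤ n` the complete chain of seat 2 reads `P_n(μ) ≤ P∞(μ) ≤ K∞(μ) = a∞(μ) = a_μ(δ[n]) ≤ g∞(μ)`, and a flip on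
the ray at `j ≥ 2(n+1)^10` needs `K_n(μ*) ≤ K(j) < P(j) ≤ a_μ(δ[n])` — in particular an equation of `Det_{n+j}` of type
`(μ♯)*`, hence (equation descent, `det_base_lt_plethysm_of_ray_lt`) an equation of `Det_n` of type `μ*`.

(The threshold `j₀` here is the ineffective uniform size of Ikenmeyer–Panova's Lemma 2.7; an effective one,
`j ≥ |μ̄| - n`, follows from the no-small-body-equations theorem of axis D, k3 gen 1 seat 2,
`det_orbitMultiplicity_eq_plethysmCoeff_of_bodySize_le`, once landed — the identification of `K∞` is the same.)

Sources: Ikenmeyer–Panova, Adv. Math. 319 (2017) Prop. 2.5, 2.6(b), Lemma 2.7; Bürgisser–Ikenmeyer–Panova, J. AMS 32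
(2019) Prop. 5.6(2); BLMW 2011 §6.4.
-/

set_option linter.dupNamespace false

namespace Summit.ValiantsHypothesis.ValiantsHypothesis.Theorems.ValuativeFlip

open scoped BigOperators
open MvPolynomial
open Literature.NumberTheory.DiophantineGeometry
open Literature.Computability.AlgebraicComplexity
open Literature.Computability.Complexity

noncomputable section

/-- **Far out on a Kadish–Landsberg ray the determinant has no equations of the ray's type** (`μ₂ ≤ n`):
there is `j₀` such that `K(j) = a(j)` and `a(j) = a_μ(δ[n])` for all `j ≥ j₀`.  Proof: one size `C` of affine
determinantal expression serves all forms of degree `n` on `Mat_n` (`exists_forall_hasDetRepr_of_isHomogeneous`);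
for `n + j ≥ C`, Ikenmeyer–Panova Prop. 2.6(b) gives `a_μ(δ[n]) ≤ K(j)`, and `K(j) ≤ a(j) = a_μ(δ[n])`
(plethysm bound; exact inner plethysm stability). [Ikenmeyer–Panova 2017 Prop. 2.5–2.6, Lemma 2.7;
Bürgisser–Ikenmeyer–Panova 2019 Prop. 5.6(2)] -/
theorem det_ray_eq_plethysm_eventually (n δ : ℕ) [NeZero n] (μ : Nat.Partition (n * δ))
    (hμ : μ.parts.card ≤ n * n) (h₂ : μ.sortedParts.getD 1 0 ≤ n) :
    ∃ j₀ : ℕ, ∀ j : ℕ, j₀ ≤ j → ∀ [NeZero (n + j)],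
      orbitMultiplicity ℂ (detFormLex ℂ (n + j)) (n + j) (partitionWeightLex (n + j) (rowLift μ j)) =
          plethysmCoeff ℂ (MatIdx (n + j)) (n + j) (partitionWeightLex (n + j) (rowLift μ j)) ∧
        plethysmCoeff ℂ (MatIdx (n + j)) (n + j) (partitionWeightLex (n + j) (rowLift μ j)) =
          plethysmCoeff ℂ (MatIdx n) n (partitionWeightLex n μ) := by
  obtain ⟨C, hC⟩ := exists_forall_hasDetRepr_of_isHomogeneous (k := ℂ) (σ := MatIdx n) n
  refine ⟨C, fun j hj _ => ?_⟩
  have ha := plethysmCoeff_rowLift_eq μ hμ h₂ j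
  refine ⟨le_antisymm ?_ ?_, ha⟩
  · exact orbitMultiplicity_le_plethysmCoeff_holds _ (NeZero.ne (n + j)) (detFormLex_isHomogeneous ℂ (n + j)) _
  · rw [ha]
    exact plethysmCoeff_le_orbitMultiplicity_rowLift μ hμ j fun f hf =>
      HasDetRepr.mono_holds (hC f hf) (by omega)

/-- **`K∞(μ) = a_μ(δ[n])`**: for `μ₂ ≤ n`, any eventual value of the determinant's ray is the inner plethysm
coefficient at the base. [Ikenmeyer–Panova 2017 §2; Bürgisser–Ikenmeyer–Panova 2019 Prop. 5.6(2); this crux, k16] -/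
theorem det_rayLimit_eq_plethysm_base (n δ : ℕ) [NeZero n] (μ : Nat.Partition (n * δ))
    (hμ : μ.parts.card ≤ n * n) (h₂ : μ.sortedParts.getD 1 0 ≤ n) {K : ℕ}
    (hK : ∃ j₀ : ℕ, ∀ j : ℕ, j₀ ≤ j →
      orbitMultiplicity ℂ (detFormLex ℂ (n + j)) (n + j) (partitionWeightLex (n + j) (rowLift μ j)) = K) :
    K = plethysmCoeff ℂ (MatIdx n) n (partitionWeightLex n μ) := by
  obtain ⟨j₁, hj₁⟩ := hK
  obtain ⟨j₂, hj₂⟩ := det_ray_eq_plethysm_eventually n δ μ hμ h₂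
  haveI : NeZero (n + max j₁ j₂) := ⟨by have := NeZero.ne n; omega⟩
  obtain ⟨h1, h2⟩ := hj₂ (max j₁ j₂) (le_max_right _ _)
  rw [← hj₁ (max j₁ j₂) (le_max_left _ _), h1, h2]

/-- **The effective sandwich of the determinant's ray** (`μ₂ ≤ n`): for every `j ≥ 2(n+1)^10`,
`K_n(μ*) ≤ K(j) ≤ a_μ(δ[n])` (`= K∞(μ)` by `det_rayLimit_eq_plethysm_base`). [this crux, k4 + k16] -/
theorem det_ray_sandwich (n δ : ℕ) [NeZero n] (μ : Nat.Partition (n * δ))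
    (hμ : μ.parts.card ≤ n * n) (h₂ : μ.sortedParts.getD 1 0 ≤ n) (j : ℕ) [NeZero (n + j)]
    (hj : 2 * (n + 1) ^ 10 ≤ j) :
    orbitMultiplicity ℂ (detFormLex ℂ n) n (partitionWeightLex n μ) ≤
        orbitMultiplicity ℂ (detFormLex ℂ (n + j)) (n + j) (partitionWeightLex (n + j) (rowLift μ j)) ∧
      orbitMultiplicity ℂ (detFormLex ℂ (n + j)) (n + j) (partitionWeightLex (n + j) (rowLift μ j)) ≤
        plethysmCoeff ℂ (MatIdx n) n (partitionWeightLex n μ) := by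
  refine ⟨det_paddingMonotone n δ μ hμ j hj, ?_⟩
  rw [← plethysmCoeff_rowLift_eq μ hμ h₂ j]
  exact orbitMultiplicity_le_plethysmCoeff_holds _ (NeZero.ne (n + j)) (detFormLex_isHomogeneous ℂ (n + j)) _

end

end Summit.ValiantsHypothesis.ValiantsHypothesis.Theorems.ValuativeFlip
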